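import Summits.NavierStokesRegularity.FunctionalMining.NoGo.TopBotEigSplitShareWallLine
import HarnessLib

/-!
# K24 — the wall reduction for EVERY real exponent `q`: `T = q²·(u(1−u))^{q−2}·ρ`, the wall zeros
# `ρ(1/3) = ρ(2/3) = 0` at the sharp share `c = c_axi(q)`, and (W) from the concavity of `ρ`

search for candidate a priori estimates; no regularity claim.

Pure one-variable real analysis over the TREE toolkit K16 part 1 (`NoGo.TopBotEigSplitShareWallLine`: `lineNsq, lineN,
lineN1, lineN2, lineT, cAxi, lineT_two_thirds`), Mathlib only. The per-`q` bricks K17 (`q = 4`), K21 (`q = 3`), K22 (`q = 6`),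
K23 (`q = 8`) each proved the sign condition (W) `0 ≤ T = q·N·N″ − (q−1)·N′²` on `(1/3, 2/3)` at `c = c_axi(q)` from a
`q`-specific polynomial closed form. This file replaces the closed forms by ONE identity valid for every real `q` and `c`:

§1 the symmetry `u ↦ 1 − u` of the line functions; §2 **the factorisation** `lineT q c u = q² · wallBr q c u` on `(0, 1)` with
`wallBr = (q−1)(u(1−u))^{q−2} − c·s^{q/2−2}·(u^{q−2}(3u² + (q−1)(2−3u)²) + (1−u)^{q−2}(3(1−u)² + (q−1)(3u−1)²)) + 3c²·s^{q−2}`,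
`s = 6u² − 6u + 2` (a polynomial identity in the atoms `u^{q−2}, (1−u)^{q−2}, s^{q/2−2}`, by `ring`; the `c²`-coefficient of `T`
is the universal monomial `3q²·s^{q−2}`), and the normalised bracket `wallRho = wallBr/(u(1−u))^{q−2}`; §3 **the wall zeros**
`wallBr q (cAxi q) (2/3) = wallBr q (cAxi q) (1/3) = 0` for every real `q > 1` (K16's wall identity: `c_axi(q)` is the smaller
root of the wall quadratic); §4 **the criterion**: if `u ↦ wallRho q c u` is concave on `[1/3, 2/3]` and non-negative at the two
walls then (W) holds on `[1/3, 2/3]` — at `c = c_axi(q)` the wall values vanish, so **concavity of `ρ` alone gives (W)**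
(`lineT_cAxi_nonneg_of_wallRhoConcave`, the concavity (W⋆) `ConcaveOn ℝ [1/3, 2/3] (wallRho q (cAxi q))` entering as a
typed HYPOTHESIS — NOT proved here for any `q`; certified numerically outside Lean for `2 ≤ q ≤ 100`, evidence
`sieveld/wall/general/`, readings not verdicts); §5 consistency: `q = 2` (`wallBr 2 c u = (1 − c)(1 − 3c)`, zero at the
`q = 2` share `1/3`) and `q = 4`, `c = 2/9` (`wallBr = (5/9)(9u(1−u) − 2)(2/3 − u(1−u))`, K17's wall identity divided by 16).

NOT claimed: (W), (N⁺), (D) or `TopBotEigSplitting q (c_axi q)` for any new `q`; nothing on `heatDissipation`. The assembly with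
K19's `topBotEigSplitting_of_line` (staged) is one line and is recorded in the evidence E-check, not here.
search for candidate a priori estimates; no regularity claim.
FILING (prove seat g27, REQUEST #40): declarations byte-identical to the no-go seat's staged `TopBotEigSplitWallReduction.STAGING.lean` f4a7506f3033f7a5; this line is the only addition.
-/

open Set

noncomputable section

namespace Summit.NavierStokesRegularity.FunctionalMining

namespace TopEig

/-! ## 1. The symmetry `u ↦ 1 − u` -/

/-- `‖A(1 − u)‖² = ‖A(u)‖²`. [bookkeeping] -/
theorem lineNsq_symm (u : ℝ) : lineNsq (1 - u) = lineNsq u := by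
  unfold lineNsq; ring

/-- `N(1 − u) = N(u)`. [bookkeeping] -/
theorem lineN_symm (q c u : ℝ) : lineN q c (1 - u) = lineN q c u := by
  unfold lineN; rw [sub_sub_cancel, lineNsq_symm]; ring

/-- `N′(1 − u) = −N′(u)`. [bookkeeping] -/
theorem lineN1_symm (q c u : ℝ) : lineN1 q c (1 - u) = -lineN1 q c u := by
  unfold lineN1; rw [sub_sub_cancel, lineNsq_symm]; ring

/-- `N″(1 − u) = N″(u)`. [bookkeeping] -/
theorem lineN2_symm (q c u : ℝ) : lineN2 q c (1 - u) = lineN2 q c u := by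
  unfold lineN2; rw [sub_sub_cancel, lineNsq_symm]; ring

/-- `T(1 − u) = T(u)`. [bookkeeping] -/
theorem lineT_symm (q c u : ℝ) : lineT q c (1 - u) = lineT q c u := by
  unfold lineT; rw [lineN_symm, lineN1_symm, lineN2_symm]; ring

/-! ## 2. The factorisation `T = q²·wallBr = q²·(u(1−u))^{q−2}·wallRho` -/

/-- **The wall bracket** `wallBr q c u = (q−1)(u(1−u))^{q−2} − c·s^{q/2−2}·(u^{q−2}(3u² + (q−1)(2−3u)²)
+ (1−u)^{q−2}(3(1−u)² + (q−1)(3u−1)²)) + 3c²·s^{q−2}`, `s = ‖A(u)‖²`. [ours] -/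
def wallBr (q c u : ℝ) : ℝ :=
  (q - 1) * (u * (1 - u)) ^ (q - 2) -
      c * lineNsq u ^ (q / 2 - 2) *
        (u ^ (q - 2) * (3 * u ^ 2 + (q - 1) * (2 - 3 * u) ^ 2) +
          (1 - u) ^ (q - 2) * (3 * (1 - u) ^ 2 + (q - 1) * (3 * u - 1) ^ 2)) +
    3 * c ^ 2 * lineNsq u ^ (q - 2)

/-- **The normalised wall bracket** `wallRho = wallBr / (u(1−u))^{q−2}`. [ours] -/
def wallRho (q c u : ℝ) : ℝ := wallBr q c u / (u * (1 - u)) ^ (q - 2)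

/-- `x^q = x^{q−2}·x²` for `x > 0`. [bookkeeping] -/
theorem rpow_eq_rpow_sub_two_mul_sq {x : ℝ} (hx : 0 < x) (q : ℝ) : x ^ q = x ^ (q - 2) * x ^ 2 := by
  rw [← Real.rpow_two, ← Real.rpow_add hx, sub_add_cancel]

/-- `x^{q−1} = x^{q−2}·x` for `x > 0`. [bookkeeping] -/
theorem rpow_sub_one_eq_rpow_sub_two_mul {x : ℝ} (hx : 0 < x) (q : ℝ) : x ^ (q - 1) = x ^ (q - 2) * x := by
  rw [show q - 1 = q - 2 + 1 by ring, Real.rpow_add hx, Real.rpow_one]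

/-- `s^{q/2} = s^{q/2−2}·s²`. [bookkeeping] -/
theorem lineNsq_rpow_half (u q : ℝ) : lineNsq u ^ (q / 2) = lineNsq u ^ (q / 2 - 2) * lineNsq u ^ 2 := by
  rw [← Real.rpow_two, ← Real.rpow_add (lineNsq_pos u), sub_add_cancel]

/-- `s^{q/2−1} = s^{q/2−2}·s`. [bookkeeping] -/
theorem lineNsq_rpow_half_sub_one (u q : ℝ) :
    lineNsq u ^ (q / 2 - 1) = lineNsq u ^ (q / 2 - 2) * lineNsq u := by
  rw [show q / 2 - 1 = q / 2 - 2 + 1 by ring, Real.rpow_add (lineNsq_pos u), Real.rpow_one]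

/-- `s^{q−2} = (s^{q/2−2}·s)²`. [bookkeeping] -/
theorem lineNsq_rpow_sub_two (u q : ℝ) : lineNsq u ^ (q - 2) = (lineNsq u ^ (q / 2 - 2) * lineNsq u) ^ 2 := by
  rw [← lineNsq_rpow_half_sub_one, ← Real.rpow_two, ← Real.rpow_mul (lineNsq_pos u).le]
  congr 1; ring

/-- `(u(1−u))^{q−2} = u^{q−2}(1−u)^{q−2}` on `(0, 1)`. [bookkeeping] -/
theorem mul_rpow_line {u : ℝ} (hu0 : 0 < u) (hu1 : u < 1) (q : ℝ) :
    (u * (1 - u)) ^ (q - 2) = u ^ (q - 2) * (1 - u) ^ (q - 2) :=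
  Real.mul_rpow hu0.le (by linarith)

/-- **The factorisation** `T = q²·wallBr` on `(0, 1)`, every real `q` and `c`. [ours] -/
theorem lineT_eq_wallBr (q c : ℝ) {u : ℝ} (hu0 : 0 < u) (hu1 : u < 1) : lineT q c u = q ^ 2 * wallBr q c u := by
  have hv : 0 < 1 - u := by linarith
  rw [lineT, lineN, lineN1, lineN2, wallBr, rpow_eq_rpow_sub_two_mul_sq hu0 q, rpow_eq_rpow_sub_two_mul_sq hv q,
    rpow_sub_one_eq_rpow_sub_two_mul hu0 q, rpow_sub_one_eq_rpow_sub_two_mul hv q, lineNsq_rpow_half u q,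
    lineNsq_rpow_half_sub_one u q, lineNsq_rpow_sub_two u q, mul_rpow_line hu0 hu1 q]
  unfold lineNsq; ring

/-- `(u(1−u))^{q−2} > 0` on `(0, 1)`. [bookkeeping] -/
theorem mul_rpow_line_pos {u : ℝ} (hu0 : 0 < u) (hu1 : u < 1) (q : ℝ) : 0 < (u * (1 - u)) ^ (q - 2) :=
  Real.rpow_pos_of_pos (mul_pos hu0 (by linarith)) _

/-- `wallBr = (u(1−u))^{q−2}·wallRho` on `(0, 1)`. [bookkeeping] -/
theorem wallBr_eq_wallRho (q c : ℝ) {u : ℝ} (hu0 : 0 < u) (hu1 : u < 1) :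
    wallBr q c u = (u * (1 - u)) ^ (q - 2) * wallRho q c u := by
  rw [wallRho, mul_div_cancel₀ _ (mul_rpow_line_pos hu0 hu1 q).ne']

/-- **`T = q²·(u(1−u))^{q−2}·ρ`** on `(0, 1)`, every real `q` and `c`. [ours] -/
theorem lineT_eq_wallRho (q c : ℝ) {u : ℝ} (hu0 : 0 < u) (hu1 : u < 1) :
    lineT q c u = q ^ 2 * (u * (1 - u)) ^ (q - 2) * wallRho q c u := by
  rw [lineT_eq_wallBr q c hu0 hu1, wallBr_eq_wallRho q c hu0 hu1, mul_assoc]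

/-- The closed form of `ρ` on `(0, 1)`: `ρ = (q−1) − c·s^{q/2−2}·((3u²+(q−1)(2−3u)²)/(1−u)^{q−2} + (3(1−u)²+(q−1)(3u−1)²)/u^{q−2})
+ 3c²·(s/(u(1−u)))^{q−2}`. [ours] -/
theorem wallRho_eq (q c : ℝ) {u : ℝ} (hu0 : 0 < u) (hu1 : u < 1) :
    wallRho q c u = (q - 1) -
        c * lineNsq u ^ (q / 2 - 2) *
          ((3 * u ^ 2 + (q - 1) * (2 - 3 * u) ^ 2) / (1 - u) ^ (q - 2) +
            (3 * (1 - u) ^ 2 + (q - 1) * (3 * u - 1) ^ 2) / u ^ (q - 2)) +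
      3 * c ^ 2 * (lineNsq u / (u * (1 - u))) ^ (q - 2) := by
  have hv : 0 < 1 - u := by linarith
  have ha := Real.rpow_pos_of_pos hu0 (q - 2)
  have hb := Real.rpow_pos_of_pos hv (q - 2)
  rw [wallRho, wallBr, Real.div_rpow (lineNsq_pos u).le (mul_pos hu0 hv).le, mul_rpow_line hu0 hu1]
  field_simp

/-- `wallBr` is symmetric under `u ↦ 1 − u`. [bookkeeping] -/
theorem wallBr_symm (q c u : ℝ) : wallBr q c (1 - u) = wallBr q c u := by
  unfold wallBr; rw [sub_sub_cancel, lineNsq_symm, mul_comm (1 - u) u]; ring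

/-- `wallRho` is symmetric under `u ↦ 1 − u`. [bookkeeping] -/
theorem wallRho_symm (q c u : ℝ) : wallRho q c (1 - u) = wallRho q c u := by
  unfold wallRho; rw [wallBr_symm, sub_sub_cancel, mul_comm (1 - u) u]

/-! ## 3. The wall zeros at the sharp share `c = c_axi(q)` -/

/-- `T(2/3) = 0` at `c = c_axi(q)`, every real `q > 1` (`c_axi` is a root of the wall quadratic). [ours] -/
theorem lineT_two_thirds_cAxi {q : ℝ} (hq : 1 < q) : lineT q (cAxi q) (2 / 3) = 0 := by
  have hd : 0 ≤ (axiS q - axiB q) ^ 2 + 4 * axiR q := by nlinarith [axiR_pos hq, sq_nonneg (axiS q - axiB q)]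
  have h1 : cAxi q - (axiS q + axiB q) / 2 = -(Real.sqrt ((axiS q - axiB q) ^ 2 + 4 * axiR q) / 2) := by
    unfold cAxi; ring
  have h2 : (cAxi q - (axiS q + axiB q) / 2) ^ 2 = ((axiS q - axiB q) ^ 2 + 4 * axiR q) / 4 := by
    rw [h1, neg_sq, div_pow, Real.sq_sqrt hd]; ring
  rw [lineT_two_thirds, h2]; ring

/-- `T(1/3) = 0` at `c = c_axi(q)`, every real `q > 1`. [bookkeeping] -/
theorem lineT_one_third_cAxi {q : ℝ} (hq : 1 < q) : lineT q (cAxi q) (1 / 3) = 0 := by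
  rw [show (1 / 3 : ℝ) = 1 - 2 / 3 by norm_num, lineT_symm]; exact lineT_two_thirds_cAxi hq

/-- **`wallBr q (c_axi q) (2/3) = 0`**, every real `q > 1`. [ours] -/
theorem wallBr_two_thirds_cAxi {q : ℝ} (hq : 1 < q) : wallBr q (cAxi q) (2 / 3) = 0 := by
  have h := lineT_eq_wallBr q (cAxi q) (by norm_num : (0 : ℝ) < 2 / 3) (by norm_num : (2 / 3 : ℝ) < 1)
  rw [lineT_two_thirds_cAxi hq] at h
  have hq0 : q ^ 2 ≠ 0 := pow_ne_zero 2 (by linarith : q ≠ 0)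
  exact (mul_eq_zero.mp h.symm).resolve_left hq0

/-- `wallBr q (c_axi q) (1/3) = 0`, every real `q > 1`. [bookkeeping] -/
theorem wallBr_one_third_cAxi {q : ℝ} (hq : 1 < q) : wallBr q (cAxi q) (1 / 3) = 0 := by
  rw [show (1 / 3 : ℝ) = 1 - 2 / 3 by norm_num, wallBr_symm]; exact wallBr_two_thirds_cAxi hq

/-- **`ρ(2/3) = 0`** at `c = c_axi(q)`, every real `q > 1`. [ours] -/
theorem wallRho_two_thirds_cAxi {q : ℝ} (hq : 1 < q) : wallRho q (cAxi q) (2 / 3) = 0 := by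
  rw [wallRho, wallBr_two_thirds_cAxi hq, zero_div]

/-- **`ρ(1/3) = 0`** at `c = c_axi(q)`, every real `q > 1`. [ours] -/
theorem wallRho_one_third_cAxi {q : ℝ} (hq : 1 < q) : wallRho q (cAxi q) (1 / 3) = 0 := by
  rw [wallRho, wallBr_one_third_cAxi hq, zero_div]

/-! ## 4. The criterion: concavity of `ρ` on `[1/3, 2/3]` with non-negative wall values gives (W) -/

/-- A concave function on `[1/3, 2/3]` with non-negative endpoint values is non-negative there. [bookkeeping] -/
theorem nonneg_of_concaveOn_walls {f : ℝ → ℝ} (hf : ConcaveOn ℝ (Icc (1 / 3 : ℝ) (2 / 3)) f) (h13 : 0 ≤ f (1 / 3))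
    (h23 : 0 ≤ f (2 / 3)) {u : ℝ} (hu1 : 1 / 3 ≤ u) (hu2 : u ≤ 2 / 3) : 0 ≤ f u := by
  have ha : 0 ≤ 2 - 3 * u := by linarith
  have hb : 0 ≤ 3 * u - 1 := by linarith
  have h := hf.2 (show (1 / 3 : ℝ) ∈ Icc (1 / 3 : ℝ) (2 / 3) by norm_num)
    (show (2 / 3 : ℝ) ∈ Icc (1 / 3 : ℝ) (2 / 3) by norm_num) ha hb (by ring)
  have hu : (2 - 3 * u) • (1 / 3 : ℝ) + (3 * u - 1) • (2 / 3 : ℝ) = u := by simp only [smul_eq_mul]; ring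
  rw [hu, smul_eq_mul, smul_eq_mul] at h
  nlinarith [mul_nonneg ha h13, mul_nonneg hb h23]

/-- **The criterion (general share).** If `ρ = wallRho q c` is concave on `[1/3, 2/3]` and `ρ(1/3), ρ(2/3) ≥ 0`, then
(W) `0 ≤ T` on `[1/3, 2/3]`. [ours] -/
theorem lineT_nonneg_of_wallRho_concaveOn {q c : ℝ} (hρ : ConcaveOn ℝ (Icc (1 / 3 : ℝ) (2 / 3)) (wallRho q c))
    (h13 : 0 ≤ wallRho q c (1 / 3)) (h23 : 0 ≤ wallRho q c (2 / 3)) {u : ℝ} (hu1 : 1 / 3 ≤ u) (hu2 : u ≤ 2 / 3) :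
    0 ≤ lineT q c u := by
  have hu0 : 0 < u := by linarith
  have hu1' : u < 1 := by linarith
  rw [lineT_eq_wallRho q c hu0 hu1']
  exact mul_nonneg (mul_nonneg (sq_nonneg q) (mul_rpow_line_pos hu0 hu1' q).le)
    (nonneg_of_concaveOn_walls hρ h13 h23 hu1 hu2)

/-- **The reduction.** For every real `q > 1`: the wall-reduced statement (W⋆) «`u ↦ ρ(u) = wallRho q (c_axi q) u` is
concave on `[1/3, 2/3]`» implies (W) `0 ≤ T` on `[1/3, 2/3]` at the sharp share `c = c_axi(q)` (the wall values of `ρ` vanish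
by §3). (W⋆) is NOT proved in this file for any `q`; it is a typed hypothesis (certified numerically for `2 ≤ q ≤ 100` outside
Lean, evidence `sieveld/wall/general/`, readings not verdicts). [ours] -/
theorem lineT_cAxi_nonneg_of_wallRhoConcave {q : ℝ} (hq : 1 < q)
    (h : ConcaveOn ℝ (Icc (1 / 3 : ℝ) (2 / 3)) (wallRho q (cAxi q))) {u : ℝ} (hu1 : 1 / 3 ≤ u) (hu2 : u ≤ 2 / 3) :
    0 ≤ lineT q (cAxi q) u :=
  lineT_nonneg_of_wallRho_concaveOn h (wallRho_one_third_cAxi hq).ge (wallRho_two_thirds_cAxi hq).ge hu1 hu2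

/-- Conversely, (W) at `c = c_axi(q)` on `(1/3, 2/3)` is EQUIVALENT to `0 ≤ ρ` there (the prefactor `q²(u(1−u))^{q−2}` is
positive), every real `q ≠ 0`. [ours, bookkeeping] -/
theorem lineT_nonneg_iff_wallRho_nonneg {q c : ℝ} (hq : q ≠ 0) {u : ℝ} (hu0 : 0 < u) (hu1 : u < 1) :
    0 ≤ lineT q c u ↔ 0 ≤ wallRho q c u := by
  rw [lineT_eq_wallRho q c hu0 hu1]
  have hp : 0 < q ^ 2 * (u * (1 - u)) ^ (q - 2) := mul_pos (by positivity) (mul_rpow_line_pos hu0 hu1 q)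
  exact ⟨fun h => not_lt.mp fun hρ => absurd h (not_le.mpr (mul_neg_of_pos_of_neg hp hρ)), fun h => mul_nonneg hp.le h⟩

/-! ## 5. Consistency with the proved exponents `q = 2` and `q = 4` -/

/-- `q = 2`: `wallBr 2 c u = (1 − c)(1 − 3c)` for every `u` — zero exactly at the `q = 2` share `c = 1/3` (K11) and at `c = 1`.
[ours, bookkeeping] -/
theorem wallBr_two (c u : ℝ) : wallBr 2 c u = (1 - c) * (1 - 3 * c) := by
  have hs := lineNsq_pos u
  rw [wallBr, show (2 : ℝ) - 2 = 0 by norm_num, show (2 : ℝ) / 2 - 2 = -1 by norm_num, Real.rpow_zero, Real.rpow_zero,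
    Real.rpow_zero, Real.rpow_zero, Real.rpow_neg_one]
  field_simp
  unfold lineNsq; ring

/-- `q = 4`, `c = 2/9`: `wallBr 4 (2/9) u = (5/9)(9u(1−u) − 2)(2/3 − u(1−u))` — K17's wall identity
`4NN″ − 3N′² = (3u−1)(2−3u)(80/9)(u² − u + 2/3)` divided by `q² = 16`. [ours, bookkeeping] -/
theorem wallBr_four (u : ℝ) : wallBr 4 (2 / 9) u = 5 / 9 * (9 * (u * (1 - u)) - 2) * (2 / 3 - u * (1 - u)) := by
  rw [wallBr, show (4 : ℝ) - 2 = 2 by norm_num, show (4 : ℝ) / 2 - 2 = 0 by norm_num, Real.rpow_two, Real.rpow_two,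
    Real.rpow_two, Real.rpow_two, Real.rpow_zero]
  unfold lineNsq; ring

end TopEig

end Summit.NavierStokesRegularity.FunctionalMining
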